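import Summits.ABC.ABC.Theorems.FeketeScalesScaleSubmultiplicativityNormalForms

/-!
# Crux `ScaleSubmultiplicativity` (stmt-ABC-2160): the dyadic normal form — one integer sequence

Normal forms, part III (parts I/II: `…NormalForms.lean`, `…NormalFormsConstants.lean`).  The crux of route
`FeketeScales` quantifies over ALL pairs of radical scales `(R₁, R₂)`.  This file shows that the powers of two suffice:

* `ScaleSubmultiplicativity.iff_dyadic` — `ScaleSubmultiplicativity` (stmt-ABC-2160) is equivalent to its restriction to
  the dyadic scales `R₁ = 2^i`, `R₂ = 2^j` (`i, j ≥ k₀`).  In terms of the extremal height `G` this says: the crux IS the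
  perturbed sub-additivity `g(i+j) ≤ g(i) + g(j) + log K + ((i+j) log 2)^θ` (`θ < 1`, `i, j ≥ k₀`) of ONE real sequence
  `g(n) := log G(2ⁿ)` — the exact setting of Fekete's lemma with a de Bruijn–Erdős error term, and a census over
  `O((log X)²)` dyadic pairs instead of all pairs below `X`.

Proof of the non-trivial direction (`extremal_of_dyadic`, in G-form, for any extremal height `G`): for
`2^{k₀} ≤ R₁ < 2^{i+1}`, `2^{k₀} ≤ R₂ < 2^{j+1}` (`i = ⌊log₂ R₁⌋`, `j = ⌊log₂ R₂⌋`), monotonicity of `G` and three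
dyadic instances give
`G(R₁R₂) ≤ G(2^{i+1}2^{j+1}) ≤ K e^{(L + log 4)^θ} G(2^{i+1}) G(2^{j+1})`,
`G(2^{i+1}) ≤ G(2^{k₀}2^i) ≤ K e^{(L + k₀ log 2)^θ} G(2^{k₀}) G(R₁)` (same for `j`), with `L = log R₁R₂`; by
`(x + y)^θ ≤ x^θ + y^θ` the total slack is `K³ G(2^{k₀})² e^{κ} · e^{3 L^θ}`, and `3 L^θ ≤ L^{(1+θ)/2}` above a threshold.
Consequence-free reformulation (`--supports stmt-ABC-2160`); no bearing on provability
(cf. `Cruxes/ScaleSubmultiplicativity/STRATEGY-CENSUS.md`).  Pattern: Fekete (1923); de Bruijn–Erdős (1952).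
-/

-- `Summit.<Summit>.<Problem>` is the mandated summit-side namespace (CONVENTIONS §2); for the
-- single-conjunct summit `ABC` the two coincide, so the duplicate `ABC.ABC` is deliberate.
set_option linter.dupNamespace false

namespace Summit.ABC.ABC.Theorems

open Literature.NumberTheory.DiophantineGeometry
open Summit.ABC.ABC.Theses.FeketeScales
open ScaleSubmultiplicativity.NormalForms

namespace ScaleSubmultiplicativity.Dyadic

/-- Logarithmic form of a shadow inequality: `g ≤ K e^E g₁ g₂` with everything positive gives
`log g ≤ log K + E + log g₁ + log g₂`. [folklore] -/
theorem log_le_of_le_shadow {g K E g₁ g₂ : ℝ} (hg : 0 < g) (hK : 0 < K) (hg₁ : 0 < g₁) (hg₂ : 0 < g₂)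
    (h : g ≤ K * Real.exp E * g₁ * g₂) : Real.log g ≤ Real.log K + E + Real.log g₁ + Real.log g₂ := by
  have hE : 0 < Real.exp E := Real.exp_pos E
  have := Real.log_le_log hg h
  rwa [Real.log_mul (by positivity) hg₂.ne', Real.log_mul (by positivity) hg₁.ne', Real.log_mul hK.ne' hE.ne',
    Real.log_exp] at this

/-- Slack bookkeeping: for reals `1 ≤ x ≤ u · y` with `u, y ≥ 1` and `0 ≤ θ ≤ 1`,
`(log x)^θ ≤ (log u)^θ + (log y)^θ`. [folklore] -/
theorem log_rpow_le_of_le_mul {x u y θ : ℝ} (hx : 1 ≤ x) (hu : 1 ≤ u) (hy : 1 ≤ y) (hxy : x ≤ u * y)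
    (hθ0 : 0 ≤ θ) (hθ1 : θ ≤ 1) : Real.log x ^ θ ≤ Real.log u ^ θ + Real.log y ^ θ :=
  calc Real.log x ^ θ ≤ Real.log (u * y) ^ θ :=
        Real.rpow_le_rpow (Real.log_nonneg hx) (Real.log_le_log (by linarith) hxy) hθ0
    _ ≤ Real.log u ^ θ + Real.log y ^ θ := log_mul_rpow_le hu hy hθ0 hθ1

/-- **From dyadic scales to all scales (G-form, logarithmic).**  Let `G` be an extremal height and suppose
`G(2^i 2^j) ≤ K e^{(log 2^i2^j)^θ} G(2^i) G(2^j)` for all `i, j ≥ k₀` (`k₀ ≥ 1`, `0 ≤ θ ≤ 1`, `K > 0`).  Then for all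
`R₁, R₂ ≥ 2^{k₀}`, with `L = log R₁R₂`,
`log G(R₁R₂) ≤ 3 log K + 2 log G(2^{k₀}) + (log 4)^θ + 2 (log 2^{k₀})^θ + 3 L^θ + log G(R₁) + log G(R₂)`. [folklore] -/
theorem extremal_of_dyadic {G : ℕ → ℕ}
    (hGle : ∀ a b c R : ℕ, IsABCTriple a b c → rad a b c ≤ R → c ≤ G R)
    (hGatt : ∀ R : ℕ, 2 ≤ R → ∃ a b : ℕ, IsABCTriple a b (G R) ∧ rad a b (G R) ≤ R)
    {θ K : ℝ} {k₀ : ℕ} (hθ0 : 0 ≤ θ) (hθ1 : θ ≤ 1) (hK : 0 < K) (hk₀ : 1 ≤ k₀)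
    (hD : ∀ i j : ℕ, k₀ ≤ i → k₀ ≤ j →
      (G (2 ^ i * 2 ^ j) : ℝ) ≤ K * Real.exp (Real.log (((2 ^ i : ℕ) : ℝ) * ((2 ^ j : ℕ) : ℝ)) ^ θ) *
        G (2 ^ i) * G (2 ^ j)) :
    ∀ R₁ R₂ : ℕ, 2 ^ k₀ ≤ R₁ → 2 ^ k₀ ≤ R₂ →
      Real.log (G (R₁ * R₂)) ≤ 3 * Real.log K + 2 * Real.log (G (2 ^ k₀)) + Real.log 4 ^ θ +
        2 * Real.log ((2 ^ k₀ : ℕ) : ℝ) ^ θ + 3 * Real.log ((R₁ : ℝ) * R₂) ^ θ +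
        Real.log (G R₁) + Real.log (G R₂) := by
  intro R₁ R₂ hR₁ hR₂
  -- the dyadic exponents `i = ⌊log₂ R₁⌋`, `j = ⌊log₂ R₂⌋`
  have h2k₀ : 2 ≤ 2 ^ k₀ := by
    calc 2 = 2 ^ 1 := (pow_one 2).symm
      _ ≤ 2 ^ k₀ := Nat.pow_le_pow_right (by norm_num) hk₀
  have h2R₁ : 2 ≤ R₁ := h2k₀.trans hR₁
  have h2R₂ : 2 ≤ R₂ := h2k₀.trans hR₂
  set i : ℕ := Nat.log 2 R₁ with hi
  set j : ℕ := Nat.log 2 R₂ with hj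
  have hk₀i : k₀ ≤ i := Nat.le_log_of_pow_le (by norm_num) hR₁
  have hk₀j : k₀ ≤ j := Nat.le_log_of_pow_le (by norm_num) hR₂
  have hiR₁ : 2 ^ i ≤ R₁ := Nat.pow_log_le_self 2 (by omega)
  have hjR₂ : 2 ^ j ≤ R₂ := Nat.pow_log_le_self 2 (by omega)
  have hR₁i : R₁ < 2 ^ (i + 1) := Nat.lt_pow_succ_log_self (by norm_num) R₁
  have hR₂j : R₂ < 2 ^ (j + 1) := Nat.lt_pow_succ_log_self (by norm_num) R₂
  have h2i : 2 ≤ 2 ^ i := h2k₀.trans (Nat.pow_le_pow_right (by norm_num) hk₀i)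
  have h2j : 2 ≤ 2 ^ j := h2k₀.trans (Nat.pow_le_pow_right (by norm_num) hk₀j)
  -- the three dyadic instances and the four monotonicity steps (in `ℕ`, then logarithms)
  have hD0 := hD (i + 1) (j + 1) (by omega) (by omega)
  have hD1 := hD k₀ i le_rfl hk₀i
  have hD2 := hD k₀ j le_rfl hk₀j
  have hm0 : G (R₁ * R₂) ≤ G (2 ^ (i + 1) * 2 ^ (j + 1)) :=
    extremal_mono hGle hGatt (h2R₁.trans (Nat.le_mul_of_pos_right _ (by omega)))
      (Nat.mul_le_mul hR₁i.le hR₂j.le)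
  have hm1 : G (2 ^ (i + 1)) ≤ G (2 ^ k₀ * 2 ^ i) :=
    extremal_mono hGle hGatt (le_trans h2i (Nat.pow_le_pow_right (by norm_num) (Nat.le_succ i)))
      (by rw [pow_succ]; nlinarith)
  have hm2 : G (2 ^ (j + 1)) ≤ G (2 ^ k₀ * 2 ^ j) :=
    extremal_mono hGle hGatt (le_trans h2j (Nat.pow_le_pow_right (by norm_num) (Nat.le_succ j)))
      (by rw [pow_succ]; nlinarith)
  have hm3 : G (2 ^ i) ≤ G R₁ := extremal_mono hGle hGatt h2i hiR₁
  have hm4 : G (2 ^ j) ≤ G R₂ := extremal_mono hGle hGatt h2j hjR₂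
  -- positivity of all the heights involved (`G ≥ 2` at scales `≥ 2`)
  have pos : ∀ {R : ℕ}, 2 ≤ R → (0 : ℝ) < G R := fun hR =>
    by exact_mod_cast lt_of_lt_of_le two_pos (two_le_extremal hGle hR)
  have h2ij : 2 ≤ 2 ^ (i + 1) * 2 ^ (j + 1) := le_trans (by norm_num) (Nat.mul_le_mul
    (Nat.pow_le_pow_right (by norm_num) (Nat.succ_le_succ (Nat.zero_le i)))
    (Nat.pow_le_pow_right (by norm_num) (Nat.succ_le_succ (Nat.zero_le j))))
  have h2ki : 2 ≤ 2 ^ k₀ * 2 ^ i := h2k₀.trans (Nat.le_mul_of_pos_right _ (by positivity))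
  have h2kj : 2 ≤ 2 ^ k₀ * 2 ^ j := h2k₀.trans (Nat.le_mul_of_pos_right _ (by positivity))
  have h2i1 : 2 ≤ 2 ^ (i + 1) := le_trans h2i (Nat.pow_le_pow_right (by norm_num) (Nat.le_succ i))
  have h2j1 : 2 ≤ 2 ^ (j + 1) := le_trans h2j (Nat.pow_le_pow_right (by norm_num) (Nat.le_succ j))
  have h2R₁R₂ : 2 ≤ R₁ * R₂ := h2R₁.trans (Nat.le_mul_of_pos_right _ (by omega))
  -- logarithmic forms
  have l0 := log_le_of_le_shadow (pos h2ij) hK (pos h2i1) (pos h2j1) hD0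
  have l1 := log_le_of_le_shadow (pos h2ki) hK (pos h2k₀) (pos h2i) hD1
  have l2 := log_le_of_le_shadow (pos h2kj) hK (pos h2k₀) (pos h2j) hD2
  have m0 : Real.log (G (R₁ * R₂)) ≤ Real.log (G (2 ^ (i + 1) * 2 ^ (j + 1))) :=
    Real.log_le_log (pos h2R₁R₂) (by exact_mod_cast hm0)
  have m1 : Real.log (G (2 ^ (i + 1))) ≤ Real.log (G (2 ^ k₀ * 2 ^ i)) :=
    Real.log_le_log (pos h2i1) (by exact_mod_cast hm1)
  have m2 : Real.log (G (2 ^ (j + 1))) ≤ Real.log (G (2 ^ k₀ * 2 ^ j)) :=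
    Real.log_le_log (pos h2j1) (by exact_mod_cast hm2)
  have m3 : Real.log (G (2 ^ i)) ≤ Real.log (G R₁) := Real.log_le_log (pos h2i) (by exact_mod_cast hm3)
  have m4 : Real.log (G (2 ^ j)) ≤ Real.log (G R₂) := Real.log_le_log (pos h2j) (by exact_mod_cast hm4)
  -- the three slacks against `L = log R₁R₂`
  have hR₁1 : (1 : ℝ) ≤ R₁ := by exact_mod_cast le_trans one_le_two h2R₁
  have hR₂1 : (1 : ℝ) ≤ R₂ := by exact_mod_cast le_trans one_le_two h2R₂
  have hRR1 : (1 : ℝ) ≤ (R₁ : ℝ) * R₂ := by nlinarith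
  have hk1 : (1 : ℝ) ≤ ((2 ^ k₀ : ℕ) : ℝ) := by exact_mod_cast le_trans one_le_two h2k₀
  have p0 : Real.log (((2 ^ (i + 1) : ℕ) : ℝ) * ((2 ^ (j + 1) : ℕ) : ℝ)) ^ θ ≤
      Real.log 4 ^ θ + Real.log ((R₁ : ℝ) * R₂) ^ θ := by
    refine log_rpow_le_of_le_mul ?_ (by norm_num) hRR1 ?_ hθ0 hθ1
    · exact_mod_cast le_trans (le_of_lt one_lt_two) h2ij
    · have : 2 ^ (i + 1) * 2 ^ (j + 1) ≤ 4 * (R₁ * R₂) := by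
        calc 2 ^ (i + 1) * 2 ^ (j + 1) = 4 * (2 ^ i * 2 ^ j) := by rw [pow_succ, pow_succ]; ring
          _ ≤ 4 * (R₁ * R₂) := Nat.mul_le_mul_left 4 (Nat.mul_le_mul hiR₁ hjR₂)
      exact_mod_cast this
  have p1 : Real.log (((2 ^ k₀ : ℕ) : ℝ) * ((2 ^ i : ℕ) : ℝ)) ^ θ ≤
      Real.log ((2 ^ k₀ : ℕ) : ℝ) ^ θ + Real.log ((R₁ : ℝ) * R₂) ^ θ := by
    refine log_rpow_le_of_le_mul ?_ hk1 hRR1 ?_ hθ0 hθ1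
    · exact_mod_cast le_trans (le_of_lt one_lt_two) h2ki
    · have : 2 ^ k₀ * 2 ^ i ≤ 2 ^ k₀ * (R₁ * R₂) :=
        Nat.mul_le_mul_left _ (hiR₁.trans (Nat.le_mul_of_pos_right _ (by omega)))
      exact_mod_cast this
  have p2 : Real.log (((2 ^ k₀ : ℕ) : ℝ) * ((2 ^ j : ℕ) : ℝ)) ^ θ ≤
      Real.log ((2 ^ k₀ : ℕ) : ℝ) ^ θ + Real.log ((R₁ : ℝ) * R₂) ^ θ := by
    refine log_rpow_le_of_le_mul ?_ hk1 hRR1 ?_ hθ0 hθ1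
    · exact_mod_cast le_trans (le_of_lt one_lt_two) h2kj
    · have : 2 ^ k₀ * 2 ^ j ≤ 2 ^ k₀ * (R₁ * R₂) :=
        Nat.mul_le_mul_left _ (hjR₂.trans (Nat.le_mul_of_pos_left _ (by omega)))
      exact_mod_cast this
  linarith

end ScaleSubmultiplicativity.Dyadic

open ScaleSubmultiplicativity.Dyadic

/-- **Dyadic scales suffice.**  `ScaleSubmultiplicativity` (stmt-ABC-2160) is equivalent to its restriction to the
scales `R₁ = 2^i`, `R₂ = 2^j`, `i, j ≥ k₀` — i.e. to the perturbed sub-additivity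
`log G(2^{i+j}) ≤ log G(2^i) + log G(2^j) + log K + ((i+j) log 2)^θ` of the one sequence `n ↦ log G(2ⁿ)`.
(⟸: `extremal_of_dyadic` for the extremal height of `GrowthExponent.exists_extremalHeight`, `θ⁺ = max θ 0` by
`bound_mono`, `3 L^{θ⁺} ≤ L^{(1+θ⁺)/2}` above a threshold by `SubmultOfRST.exists_threshold`, and back to the G-free
form by `iff_extremalHeight`.) [folklore] -/
theorem ScaleSubmultiplicativity.iff_dyadic :
    Summit.ABC.ABC.Theses.FeketeScales.ScaleSubmultiplicativity ↔
    ∃ θ : ℝ, θ < 1 ∧ ∃ K : ℝ, 0 < K ∧ ∃ k₀ : ℕ, ∀ i j : ℕ, k₀ ≤ i → k₀ ≤ j → ∀ a b c : ℕ,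
      IsABCTriple a b c → rad a b c ≤ 2 ^ i * 2 ^ j → ∃ a₁ b₁ c₁ a₂ b₂ c₂ : ℕ, IsABCTriple a₁ b₁ c₁ ∧
        rad a₁ b₁ c₁ ≤ 2 ^ i ∧ IsABCTriple a₂ b₂ c₂ ∧ rad a₂ b₂ c₂ ≤ 2 ^ j ∧
        (c : ℝ) ≤ K * Real.exp (Real.log (((2 ^ i : ℕ) : ℝ) * ((2 ^ j : ℕ) : ℝ)) ^ θ) * c₁ * c₂ := by
  constructor
  · rintro ⟨θ, hθ1, K, hK, R₀, hS⟩
    refine ⟨θ, hθ1, K, hK, R₀, fun i j hi hj => hS (2 ^ i) (2 ^ j) ?_ ?_⟩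
    · exact (Nat.lt_two_pow_self).le.trans (Nat.pow_le_pow_right (by norm_num) hi)
    · exact (Nat.lt_two_pow_self).le.trans (Nat.pow_le_pow_right (by norm_num) hj)
  · rintro ⟨θ, hθ1, K, hK, k₀, hS⟩
    obtain ⟨G, hGle, hGatt⟩ := ScaleSubmultiplicativity.GrowthExponent.exists_extremalHeight
    -- normalise: `θ⁺ = max θ 0`, `k₁ = max k₀ 1`, and pass to the G-form on dyadic scales
    set t : ℝ := max θ 0 with ht_def
    have ht0 : 0 ≤ t := le_max_right _ _
    have ht1 : t < 1 := max_lt hθ1 one_pos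
    set k₁ : ℕ := max k₀ 1 with hk₁_def
    have hk₁ : 1 ≤ k₁ := le_max_right _ _
    have h2k₁ : 2 ≤ 2 ^ k₁ := by
      calc 2 = 2 ^ 1 := (pow_one 2).symm
        _ ≤ 2 ^ k₁ := Nat.pow_le_pow_right (by norm_num) hk₁
    have hD : ∀ i j : ℕ, k₁ ≤ i → k₁ ≤ j →
        (G (2 ^ i * 2 ^ j) : ℝ) ≤ K * Real.exp (Real.log (((2 ^ i : ℕ) : ℝ) * ((2 ^ j : ℕ) : ℝ)) ^ t) *
          G (2 ^ i) * G (2 ^ j) := by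
      intro i j hi hj
      have hi₀ : k₀ ≤ i := (le_max_left _ _).trans hi
      have hj₀ : k₀ ≤ j := (le_max_left _ _).trans hj
      have h2i : 2 ≤ 2 ^ i := h2k₁.trans (Nat.pow_le_pow_right (by norm_num) hi)
      have h2j : 2 ≤ 2 ^ j := h2k₁.trans (Nat.pow_le_pow_right (by norm_num) hj)
      have h2 : 2 ≤ 2 ^ i * 2 ^ j := h2i.trans (Nat.le_mul_of_pos_right _ (by positivity))
      have h3 : 3 ≤ 2 ^ i * 2 ^ j := le_trans (by norm_num) (Nat.mul_le_mul h2i h2j)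
      have hG := extremal_le_of_free hGle hGatt hK.le h2 (hS i j hi₀ hj₀)
      exact ScaleSubmultiplicativity.bound_mono (le_max_left θ 0) le_rfl hK.le h3 hG
    have hall := extremal_of_dyadic hGle hGatt ht0 ht1.le hK hk₁ hD
    -- absorb `3 L^t` into `L^{(1+t)/2}` above a threshold
    set s : ℝ := (1 - t) / 2 with hs_def
    have hs : 0 < s := by rw [hs_def]; linarith
    obtain ⟨N₀, hN₀⟩ := SubmultOfRST.exists_threshold 3 hs
    set κ : ℝ := 3 * Real.log K + 2 * Real.log (G (2 ^ k₁)) + Real.log 4 ^ t +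
      2 * Real.log ((2 ^ k₁ : ℕ) : ℝ) ^ t with hκ_def
    rw [ScaleSubmultiplicativity.iff_extremalHeight G hGle hGatt]
    refine ⟨(1 + t) / 2, by linarith, Real.exp κ, Real.exp_pos κ, max (2 ^ k₁) N₀, fun R₁ R₂ hR₁ hR₂ => ?_⟩
    have hkR₁ : 2 ^ k₁ ≤ R₁ := (le_max_left _ _).trans hR₁
    have hkR₂ : 2 ^ k₁ ≤ R₂ := (le_max_left _ _).trans hR₂
    have h2R₁ : 2 ≤ R₁ := h2k₁.trans hkR₁
    have h2R₂ : 2 ≤ R₂ := h2k₁.trans hkR₂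
    have hlog := hall R₁ R₂ hkR₁ hkR₂
    -- `3 L^t ≤ L^{(1+t)/2}`
    have hLpos : 0 < Real.log ((R₁ : ℝ) * R₂) := by
      have : (1 : ℝ) < (R₁ : ℝ) * R₂ := by
        have h1 : (2 : ℝ) ≤ R₁ := by exact_mod_cast h2R₁
        have h2 : (2 : ℝ) ≤ R₂ := by exact_mod_cast h2R₂
        nlinarith
      exact Real.log_pos this
    have hthr : 3 ≤ Real.log ((R₁ : ℝ) * R₂) ^ s := by
      have hN : N₀ ≤ R₁ * R₂ := ((le_max_right _ _).trans hR₁).trans (Nat.le_mul_of_pos_right _ (by omega))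
      have := hN₀ (R₁ * R₂) hN
      push_cast at this
      exact this
    have habs : 3 * Real.log ((R₁ : ℝ) * R₂) ^ t ≤ Real.log ((R₁ : ℝ) * R₂) ^ ((1 + t) / 2) := by
      have hsum' : (1 + t) / 2 = s + t := by rw [hs_def]; ring
      rw [hsum', Real.rpow_add hLpos]
      exact mul_le_mul_of_nonneg_right hthr (Real.rpow_nonneg hLpos.le t)
    -- exponentiate
    have pos : ∀ {R : ℕ}, 2 ≤ R → (0 : ℝ) < G R := fun hR =>
      by exact_mod_cast lt_of_lt_of_le two_pos (two_le_extremal hGle hR)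
    have h2R₁R₂ : 2 ≤ R₁ * R₂ := h2R₁.trans (Nat.le_mul_of_pos_right _ (by omega))
    have hE : 0 < Real.exp (Real.log ((R₁ : ℝ) * R₂) ^ ((1 + t) / 2)) := Real.exp_pos _
    have hfin : Real.log (G (R₁ * R₂)) ≤
        Real.log (Real.exp κ * Real.exp (Real.log ((R₁ : ℝ) * R₂) ^ ((1 + t) / 2)) * G R₁ * G R₂) := by
      have p1 : 0 < Real.exp κ * Real.exp (Real.log ((R₁ : ℝ) * R₂) ^ ((1 + t) / 2)) :=
        mul_pos (Real.exp_pos κ) hE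
      have p2 := mul_pos p1 (pos h2R₁)
      rw [Real.log_mul p2.ne' (pos h2R₂).ne', Real.log_mul p1.ne' (pos h2R₁).ne',
        Real.log_mul (Real.exp_pos κ).ne' hE.ne', Real.log_exp, Real.log_exp, hκ_def]
      linarith
    have p3 : 0 < Real.exp κ * Real.exp (Real.log ((R₁ : ℝ) * R₂) ^ ((1 + t) / 2)) * G R₁ * G R₂ :=
      mul_pos (mul_pos (mul_pos (Real.exp_pos κ) hE) (pos h2R₁)) (pos h2R₂)
    exact (Real.log_le_log_iff (pos h2R₁R₂) p3).mp hfin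

end Summit.ABC.ABC.Theorems
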